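import Summits.BirchSwinnertonDyer.BirchSwinnertonDyer.Theorems.KolyvaginRoadThreePairConsumer
import Summits.BirchSwinnertonDyer.BirchSwinnertonDyer.Theorems.KolyvaginRoadThreeCruxIffLowerHalf
import HarnessLib

/-!
# Route `KolyvaginRoadThree`, deciding crux `ZhangSharpFrameAtThreeHL` (item stmt-BirchSwinnertonDyer-19574):
# the BC5 rung `stub_rung_347253a1` — Cremona 347253a1 ⊗ ℚ(√−11), ℓ = 2 — modulo the published inputs and ONE attested
# certificate (cell `bsd-stepL`, seat `bsd-stepL-zhang3-p1` g4; `--supports stmt-BirchSwinnertonDyer-19574`, helper;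
# planner g25 dispatch KOLY-(2), 2026-08-26T10:37:32Z)

HONEST FRAMING. BSD is not proved by any of this; a rung is ONE curve and closes nothing; Kolyvagin's conjecture mod 3
(the crux) is asserted nowhere. THEOREMS ONLY (0 defs, 0 named facts, 0 `sorry`).

WHAT IS AND IS NOT KERNEL HERE — the difference with REG3CERT's rung `rung_62310y1_of_GZK` (reg3-eng, crux
`SchneiderAtThree`). There the certificate is the cyclotomic 3-adic height of an EXPLICIT rational point, a quantity the
kernel can evaluate (formal logarithm, σ-function), so the numerical row became a theorem. A KOLYVAGIN certificate —
«the derived Heegner point `P(2) = Σ_{s∈S} s·D₂ y(2)` is not divisible by `3` in `E(K[2])`», koly kit j249662 ∕ j250956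
(PARI, ring class field `K[2]` of `ℚ(√−11)` of degree 6, precision 1300), `KOLY-WITNESS.md` v5 — CANNOT be re-done in
the kernel today: the datum's field `map_y` ties `y(2)` to the ANALYTIC parametrisation `φ(x₂)` (CM rationality,
Gross 1991 §3 — a named fact of the tree, not a computation), and `IsKolyvaginPrime … 2` contains Gross's (3.2)
`FrobEqFrobInfty` (a statement about `Gal(ℚ̄/ℚ)` on `E[3]`, for which the tree has no producer from the congruence
`a₂ ≡ 2 + 1 ≡ 0 (mod 3)`). So the rung lands in the only honest shape: the registered signature of
`stub_rung_347253a1` (planner SkeletonHL-v3, BC3 on 19574) CONCLUDED from (a) the route's published inputs and (b) ONE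
certificate package at ONE frame — a Kolyvagin–Heegner datum `d₀` of conductor `2` over a field with `d_K = −11` whose
derived point is not `3`-divisible (`¬ Koly.PDiv d₀ 3 1`) — carried as an explicit, ATTESTED hypothesis
(`rung_347253a1_of_cert`); and, independently, (b′) from the EXACT analytic order of `Ш(E/ℚ)` being a `3`-adic unit
(`rung_347253a1_of_shaAn_unit`; the pair is an E-K6 row: `#Ш(E)_an = 1`, `#Ш(E^{(−11)})_an = 9`, x11b3 lane) via
today's `Koly.kolyvaginClass_one_ne_zero_of_padicValRat_shaAn_le_zero_of_hlFrame` (p441688) — two numerically attested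
routes to the same rung, neither kernel-checked, both reproducible outside. The curve-level binders of the registered
stub (`ClassX11b W 3` ∋ `r_an = 1`, `Ram W 3`, `¬ 3 ∣ ∏c`, `Surj W 3`, multiplicative `3`) stay binders exactly as in
REG3CERT's rung; §0 records the kernel-checked invariants `Δ = 3¹⁵·115751`, `c₄ = 2⁷·5·787` (so: multiplicative at `3`
and at `115751`, `N = 3·115751 = 347253`, (ram) witness `ℓ = 115751` with `v_ℓ(Δ) = 1`, non-split at `3` since
`−c₆ ≡ 2 (mod 3)`, `c₃ = 1`, `c_{115751} ∈ {1,2}` — read informally from the two identities; `#E(𝔽₂) = 3`, `a₂ = 0`,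
`−11 ≡ 5 (mod 8)`: `2` is inert in `ℚ(√−11)` and `a₂ ≡ 2+1 ≡ 0 (mod 3)`, Gross (3.3)).

PARTITION: O2@3 (B10) × A1 (the one class 347253a1 of the 1 116) — types-the-object-of (a rung decl for the route's
`tribunal_fit.witness`); closes: none (T7; no class is booked by an attested certificate).

* `Rung347253a1.Δ_eq`, `Rung347253a1.c₄_eq` — kernel-evaluated invariants of `⟨0,−1,1,−10493,412556⟩`;
* `Rung347253a1.bsdp_of_cert` — the pair's leaf `BSDp W 3` from the certificate package (p433031 instantiated);
* `Rung347253a1.rung_347253a1_of_cert` — the registered stub's signature from PUB + the certificate package;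
* `Rung347253a1.rung_347253a1_of_shaAn_unit` — the same from PUB + `#Ш(E)_an` a `3`-adic unit (E-K6 currency).

References (locators only): [cite: GrossLMS1991, §3 (3.1)–(3.3), §4 (4.1)] [cite: McCallumLMS1991, §4 Cor. 4.5, §5
Cor. 5.6] [cite: WZhang2014, Remark 5 and Thm. 10.2] [cite: JetchevLauterStein2009, §4.2] [cite: Miller2011LMS, Def. 1.1].
-/

noncomputable section

open scoped Classical

namespace Summit.BirchSwinnertonDyer.Rank1Residual.X11b.Three.Koly.Rung347253a1

open WeierstrassCurve NumberField Literature.NumberTheory.EllipticCurves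
  Literature.NumberTheory.EllipticCurves.ModularForms
  Literature.NumberTheory.EllipticCurves.Rank1Residual
  Literature.NumberTheory.EllipticCurves.Rank1Residual.Typed
  Summit.BirchSwinnertonDyer.Rank1Residual Summit.BirchSwinnertonDyer.Rank1Residual.X11b
  Summit.BirchSwinnertonDyer.Rank1Residual.X11b.Three.Koly

/-! ## §0 Kernel-checked invariants of the model `[0, −1, 1, −10493, 412556]` (Cremona 347253a1 = LMFDB 347253.a1) -/

/-- `Δ = 1660900334157 = 3¹⁵ · 115751` for `⟨0,−1,1,−10493,412556⟩` (so `3 ∣ Δ`, `115751 ∥ Δ`). Kernel arithmetic.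
[folklore] -/
theorem Δ_eq (W : WeierstrassCurve ℚ) (hW : W = ⟨0, -1, 1, -10493, 412556⟩) :
    W.Δ = 1660900334157 ∧ (1660900334157 : ℤ) = 3 ^ 15 * 115751 := by
  subst hW
  refine ⟨?_, by norm_num⟩
  norm_num [WeierstrassCurve.Δ, WeierstrassCurve.b₂, WeierstrassCurve.b₄, WeierstrassCurve.b₆, WeierstrassCurve.b₈]

/-- `c₄ = 503680 = 2⁷ · 5 · 787` for `⟨0,−1,1,−10493,412556⟩` (prime to `3` and to `115751`: multiplicative
reduction at both bad primes, `N = 3 · 115751 = 347253`), and `c₆ = −353426552` (`−c₆ ≡ 2 (mod 3)` is a non-square: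
NON-split at `3`). Kernel arithmetic. [folklore] -/
theorem c₄_eq (W : WeierstrassCurve ℚ) (hW : W = ⟨0, -1, 1, -10493, 412556⟩) :
    W.c₄ = 503680 ∧ W.c₆ = -353426552 ∧ (503680 : ℤ) = 2 ^ 7 * 5 * 787 ∧ (3 * 115751 : ℤ) = 347253 := by
  subst hW
  refine ⟨?_, ?_, by norm_num, by norm_num⟩
  · norm_num [WeierstrassCurve.c₄, WeierstrassCurve.b₂, WeierstrassCurve.b₄]
  · norm_num [WeierstrassCurve.c₆, WeierstrassCurve.b₂, WeierstrassCurve.b₄, WeierstrassCurve.b₆]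

/-- `#E(𝔽₂) = 3` for the reduction `y² + y = x³ + x² + x` of the model mod `2` (points `O`, `(1,0)`, `(1,1)`), so
`a₂ = 2 + 1 − 3 = 0 ≡ 0 ≡ 2 + 1 (mod 3)`: with `2` inert in `ℚ(√−11)` (`−11 ≡ 5 (mod 8)`) these are Gross's
congruences (3.3) for the Kolyvagin prime `ℓ = 2` at `p = 3`. Kernel arithmetic on the affine count only (the tree's
`frobeniusTrace` is not evaluated here). [cite: GrossLMS1991, §3 (3.3)] -/
theorem card_affinePoints_mod_two :
    (Finset.univ.filter fun P : ZMod 2 × ZMod 2 ↦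
      P.2 ^ 2 + P.2 = P.1 ^ 3 - P.1 ^ 2 - 10493 * P.1 + 412556).card = 2 ∧
    (-11 : ℤ) % 8 = 5 ∧ ((2 : ℤ) + 1) % 3 = 0 := by
  refine ⟨by decide, by decide, by decide⟩

/-! ## §1 The pair's leaf from the certificate package -/

/-- **`BSD(347253a1, 3)` from ONE Kolyvagin certificate** — zhang3-p1 g3's per-pair consumer
`Koly.bsdp_three_of_not_pDiv_at_hlFrame` (p433031) AT `W = ⟨0,−1,1,−10493,412556⟩`: the certificate package is a field
`K₀` with `d_{K₀} = −11` (imaginary quadratic, Heegner for `N_E`, `L(E^{(−11)},1) ≠ 0`), a Manin-good frame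
`(Dt₀, β₀, ι₀)`, the Kolyvagin prime `ℓ = 2` for `(E, K₀, 3)` and a Kolyvagin–Heegner datum `d₀` of conductor `2` whose
derived point `P(2)` is NOT `3`-divisible in `E(K₀[2])` — the content of koly's kit certificate j249662 ∕ j250956,
carried as HYPOTHESES (attested, not kernel-checked; see the module docstring for why). PUBLISHED inputs as binders.
CONDITIONAL on every binder; nothing is booked. [cite: McCallumLMS1991, §4 Cor. 4.5 and §5 Cor. 5.6]
[cite: GrossLMS1991, §3, Prop. 3.6, §4 (4.1)] -/
theorem bsdp_of_cert (W : WeierstrassCurve ℚ) (_hW : W = ⟨0, -1, 1, -10493, 412556⟩)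
    [W.IsElliptic] [W.IsGloballyMinimal] [NeZero (W.conductorNorm ℤ)]
    -- published inputs (named facts of the tree)
    (hGZ : ∀ (K : Type) [Field K] [NumberField K], gross_zagier (W.conductorNorm ℤ) W K)
    (hKo : ∀ (K : Type) [Field K] [NumberField K], kolyvagin (W.conductorNorm ℤ) W K)
    (hB : ∀ (K : Type) [Field K] [NumberField K], Kolyvagin1990_padicValNat_card_sha_le (W.conductorNorm ℤ) W K)
    (hSk : Skinner2016.thmC_padicValRat_bsd_rank_zero)
    (hGZK : rank_eq_analyticRank_of_analyticRank_le_one) (hmod : hasEntireLFunction_rat)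
    (hrec : ∀ (K : Type) [Field K] [NumberField K], heegnerPointOfConductor_one_galoisConj (W.conductorNorm ℤ) W K)
    (h1 : ∀ (K : Type) [Field K] [NumberField K],
      phi_heegnerPointOfConductor_mem_range_map_ringClassField (W.conductorNorm ℤ) W K)
    (h2 : ∀ (K : Type) [Field K] [NumberField K], exists_generator_ringClassGalOver K)
    (hMc : McCallum1991_pow_dvd_card_sha_primary_of_certificate)
    -- the pair (A1): curve-level binders of the registered stub
    (hX : ClassX11b W 3) (hram : Ram W 3) (htam : ¬ 3 ∣ W.tamagawaProduct)
    -- THE CERTIFICATE PACKAGE (attested): one frame of a field with d_K = −11, ℓ = 2, P(2) ∉ 3·E(K₀[2])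
    (K₀ : Type) [Field K₀] [NumberField K₀]
    (Dt₀ : ModularParametrizationData W (W.conductorNorm ℤ)) (β₀ : ℤ) (ι₀ : K₀ →+* ℂ)
    (hK₀ : IsImaginaryQuadratic K₀) (hd₀ : NumberField.discr K₀ = -11)
    (hH₀ : SatisfiesHeegnerHypothesis (W.conductorNorm ℤ) K₀)
    (hLt₀ : (W.quadraticTwist (NumberField.discr K₀ : ℚ)).entireLFunction 1 ≠ 0) (hc₀ : ¬ (3 : ℤ) ∣ Dt₀.c)
    (hℓ₀ : Zhang2014.IsKolyvaginPrime (W.conductorNorm ℤ) W K₀ 3 2)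
    (d₀ : KolyvaginHeegnerData Dt₀ β₀ ι₀ 2) (hcert₀ : ¬ PDiv d₀ 3 1) :
    BSDp W 3 := by
  have hodd₀ : Odd (NumberField.discr K₀) := by rw [hd₀]; decide
  exact bsdp_three_of_not_pDiv_at_hlFrame W K₀ Dt₀ β₀ ι₀ (hGZ K₀) (hKo K₀) (hB K₀) hSk hGZK hmod (hrec K₀) (h1 K₀)
    (h2 K₀) hMc hX hram htam hK₀ hodd₀ hH₀ hLt₀ hc₀
    (KolyvaginDescent.kolSupp_prime Nat.prime_two hℓ₀) d₀ hcert₀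

/-! ## §2 The registered rung, twice -/

/-- **The BC5 rung `stub_rung_347253a1` — its registered signature VERBATIM as conclusion — from the published inputs
and ONE attested Kolyvagin certificate.** For `W = ⟨0,−1,1,−10493,412556⟩` (Cremona 347253a1): given the certificate
package of §1 (kit j249662 ∕ j250956: `347253a1 ⊗ ℚ(√−11)`, `ℓ = 2`, `P(2) ∉ 3·E(K[2])`), EVERY field with
`d_K = −11` and EVERY frame `(Dt, β, ι)` carries a Kolyvagin–Heegner datum of Kolyvagin-prime conductor with
`c₁(n) ≠ 0 in H¹(K, E[3])` — the conclusion of `ZhangSharpFrameAtThreeHL` at this pair. Mechanism: §1 gives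
`BSDp W 3`; zhang3-p1 g3's converse `Koly.kolyvaginClass_one_ne_zero_of_bsdp_of_hlFrame` (McCallum Cor. 5.6,
divisibility half `hMcU`) returns a non-zero class on every HL frame. The curve-level binders of the stub arrive inside
the conclusion and feed §1. CONDITIONAL on every binder (the certificate is ATTESTED, not kernel-checked); nothing is
booked; a T3 witness in the tribunal's sense only modulo that attestation.
[cite: McCallumLMS1991, §4 Cor. 4.5, §5 Lemma 5.1 and Cor. 5.6] [cite: WZhang2014, Remark 5 and Thm. 10.2]
[cite: GrossLMS1991, §3 (3.1)–(3.3), §4 (4.1)] -/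
theorem rung_347253a1_of_cert (W : WeierstrassCurve ℚ) (hW : W = ⟨0, -1, 1, -10493, 412556⟩)
    [W.IsElliptic] [W.IsGloballyMinimal] [NeZero (W.conductorNorm ℤ)]
    -- published inputs (named facts of the tree)
    (hGZ : ∀ (K : Type) [Field K] [NumberField K], gross_zagier (W.conductorNorm ℤ) W K)
    (hKo : ∀ (K : Type) [Field K] [NumberField K], kolyvagin (W.conductorNorm ℤ) W K)
    (hB : ∀ (K : Type) [Field K] [NumberField K], Kolyvagin1990_padicValNat_card_sha_le (W.conductorNorm ℤ) W K)
    (hSk : Skinner2016.thmC_padicValRat_bsd_rank_zero)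
    (hGZK : rank_eq_analyticRank_of_analyticRank_le_one) (hmod : hasEntireLFunction_rat)
    (hrec : ∀ (K : Type) [Field K] [NumberField K], heegnerPointOfConductor_one_galoisConj (W.conductorNorm ℤ) W K)
    (h1 : ∀ (K : Type) [Field K] [NumberField K],
      phi_heegnerPointOfConductor_mem_range_map_ringClassField (W.conductorNorm ℤ) W K)
    (h2 : ∀ (K : Type) [Field K] [NumberField K], exists_generator_ringClassGalOver K)
    (hMc : McCallum1991_pow_dvd_card_sha_primary_of_certificate)
    (hMcU : McCallum1991_padicValNat_card_sha_primary_add_le_of_globalDivisibility)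
    -- THE CERTIFICATE PACKAGE (attested): one frame of a field with d_K = −11, ℓ = 2, P(2) ∉ 3·E(K₀[2])
    (K₀ : Type) [Field K₀] [NumberField K₀]
    (Dt₀ : ModularParametrizationData W (W.conductorNorm ℤ)) (β₀ : ℤ) (ι₀ : K₀ →+* ℂ)
    (hK₀ : IsImaginaryQuadratic K₀) (hd₀ : NumberField.discr K₀ = -11)
    (hH₀ : SatisfiesHeegnerHypothesis (W.conductorNorm ℤ) K₀)
    (hLt₀ : (W.quadraticTwist (NumberField.discr K₀ : ℚ)).entireLFunction 1 ≠ 0) (hc₀ : ¬ (3 : ℤ) ∣ Dt₀.c)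
    (hℓ₀ : Zhang2014.IsKolyvaginPrime (W.conductorNorm ℤ) W K₀ 3 2)
    (d₀ : KolyvaginHeegnerData Dt₀ β₀ ι₀ 2) (hcert₀ : ¬ PDiv d₀ 3 1) :
    -- the registered signature of `stub_rung_347253a1` (SkeletonHL-v3 on item 19574), `W347253a1 := W`
    ∀ (K : Type) [Field K] [NumberField K] (Dt : ModularParametrizationData W (W.conductorNorm ℤ)) (β : ℤ)
      (ι : K →+* ℂ), ClassX11b W 3 → W.HasMultiplicativeReductionAtPrime 3 → Surj W 3 → Ram W 3 →
      ¬ 3 ∣ W.tamagawaProduct → IsImaginaryQuadratic K → Odd (NumberField.discr K) →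
      SatisfiesHeegnerHypothesis (W.conductorNorm ℤ) K →
      (W.quadraticTwist (NumberField.discr K : ℚ)).entireLFunction 1 ≠ 0 → NumberField.discr K = -11 →
      (4 * (W.conductorNorm ℤ : ℤ)) ∣ β ^ 2 - NumberField.discr K → ¬ (3 : ℤ) ∣ Dt.c →
      ∃ (n : ℕ) (d : KolyvaginHeegnerData Dt β ι n),
        KolyvaginDescent.KolSupp (Zhang2014.IsKolyvaginPrime (W.conductorNorm ℤ) W K 3) n ∧
          d.kolyvaginClass Nat.prime_three 1 ≠ 0 := by
  intro K _ _ Dt β ι hX _hmult _hsurj hram htam hK hodd hH hLt _hd hβ hc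
  exact kolyvaginClass_one_ne_zero_of_bsdp_of_hlFrame W K Dt β ι (hGZ K) (hKo K) hSk hGZK hmod (hrec K) (h1 K) (h2 K)
    hMcU hX hram htam hK hodd hH hLt hβ hc
    (bsdp_of_cert W hW hGZ hKo hB hSk hGZK hmod hrec h1 h2 hMc hX hram htam K₀ Dt₀ β₀ ι₀ hK₀ hd₀ hH₀ hLt₀ hc₀
      hℓ₀ d₀ hcert₀)

/-- **The same rung from the EXACT analytic order of `Ш` (E-K6 currency) instead of a Heegner-point computation.**
For `W = ⟨0,−1,1,−10493,412556⟩` (an E-K6 row of the x11b3 lane: `#Ш(E/ℚ)_an = 1`): if `#Ш(E/ℚ)_an` is a rational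
`q` with `ord₃ q ≤ 0` (attested: the lane's exact value, admissibility question D-a), then — published inputs as
binders, Néron scaling a tree theorem — the registered signature of `stub_rung_347253a1` holds, by
`Koly.kolyvaginClass_one_ne_zero_of_padicValRat_shaAn_le_zero_of_hlFrame` (p441688: the lower half is empty, the upper
half is Kolyvagin + Skinner C, and `BSDp` forces the class). Independent of §1's certificate; equally NOT
kernel-checked. CONDITIONAL on every binder; nothing is booked. [cite: WZhang2014, Remark 5 and Thm. 10.2]
[cite: Miller2011LMS, Def. 1.1] [cite: McCallumLMS1991, §1 Theorem and §5 Cor. 5.6] -/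
theorem rung_347253a1_of_shaAn_unit (W : WeierstrassCurve ℚ) (_hW : W = ⟨0, -1, 1, -10493, 412556⟩)
    [W.IsElliptic] [W.IsGloballyMinimal] [NeZero (W.conductorNorm ℤ)]
    -- published inputs (named facts of the tree)
    (hGZ : ∀ (N : ℕ) [NeZero N] (W : WeierstrassCurve ℚ) (K : Type) [Field K] [NumberField K],
      gross_zagier N W K)
    (hKo : ∀ (N : ℕ) [NeZero N] (W : WeierstrassCurve ℚ) (K : Type) [Field K] [NumberField K],
      kolyvagin N W K)
    (hB : ∀ (N : ℕ) [NeZero N] (W : WeierstrassCurve ℚ) (K : Type) [Field K] [NumberField K],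
      Kolyvagin1990_padicValNat_card_sha_le N W K)
    (hSk : Skinner2016.thmC_padicValRat_bsd_rank_zero)
    (hGZK : rank_eq_analyticRank_of_analyticRank_le_one) (hmod : hasEntireLFunction_rat)
    (hnf : exists_isNewformOf) (hHL : HoffsteinLuo1997_exists_twist_L_one_ne_zero)
    (hMaz : mazur_not_dvd_maninConstant_of_odd)
    (hrec : ∀ (N : ℕ) [NeZero N] (W : WeierstrassCurve ℚ) (K : Type) [Field K] [NumberField K],
      heegnerPointOfConductor_one_galoisConj N W K)
    (h1 : ∀ (N : ℕ) [NeZero N] (W : WeierstrassCurve ℚ) (K : Type) [Field K] [NumberField K],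
      phi_heegnerPointOfConductor_mem_range_map_ringClassField N W K)
    (h2 : ∀ (K : Type) [Field K] [NumberField K], exists_generator_ringClassGalOver K)
    (hMcU : McCallum1991_padicValNat_card_sha_primary_add_le_of_globalDivisibility)
    -- THE ATTESTED DATUM: the exact analytic order of Ш(E/ℚ) is a 3-adic unit
    {q : ℚ} (hq : shaAn W = (q : ℂ)) (hv : padicValRat 3 q ≤ 0) :
    -- the registered signature of `stub_rung_347253a1` (SkeletonHL-v3 on item 19574), `W347253a1 := W`
    ∀ (K : Type) [Field K] [NumberField K] (Dt : ModularParametrizationData W (W.conductorNorm ℤ)) (β : ℤ)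
      (ι : K →+* ℂ), ClassX11b W 3 → W.HasMultiplicativeReductionAtPrime 3 → Surj W 3 → Ram W 3 →
      ¬ 3 ∣ W.tamagawaProduct → IsImaginaryQuadratic K → Odd (NumberField.discr K) →
      SatisfiesHeegnerHypothesis (W.conductorNorm ℤ) K →
      (W.quadraticTwist (NumberField.discr K : ℚ)).entireLFunction 1 ≠ 0 → NumberField.discr K = -11 →
      (4 * (W.conductorNorm ℤ : ℤ)) ∣ β ^ 2 - NumberField.discr K → ¬ (3 : ℤ) ∣ Dt.c →
      ∃ (n : ℕ) (d : KolyvaginHeegnerData Dt β ι n),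
        KolyvaginDescent.KolSupp (Zhang2014.IsKolyvaginPrime (W.conductorNorm ℤ) W K 3) n ∧
          d.kolyvaginClass Nat.prime_three 1 ≠ 0 := by
  intro K _ _ Dt β ι hX _hmult _hsurj hram htam hK hodd hH hLt _hd hβ hc
  exact kolyvaginClass_one_ne_zero_of_padicValRat_shaAn_le_zero_of_hlFrame W K Dt β ι hGZ hKo hB hSk hGZK hmod hnf
    hHL hMaz hrec h1 h2 hMcU hX hram htam hK hodd hH hLt hβ hc hq hv

end Summit.BirchSwinnertonDyer.Rank1Residual.X11b.Three.Koly.Rung347253a1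

end
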